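import Literature.NumberTheory.DiophantineGeometry.GeneralizedFermatTwoPowerCoefficientFreySwanEightProofs
import Literature.NumberTheory.EllipticCurves.OrdinaryReductionInertiaShapeProofs
import Literature.NumberTheory.EllipticCurves.OrdinaryReductionPeuRamifieProofs
import Literature.NumberTheory.EllipticCurves.SupersingularInertiaShapeProofs
import Literature.NumberTheory.EllipticCurves.MultiplicativeReductionPeuRamifieProofs
import HarnessLib

/-!
# Ribet 1997, Theorem 3 along Serre's road: Serre's weight-`2` statement at `p` is a theorem at the
# canonical local datum; Theorem 3 from `khare_wintenberger` and `mazurKenku_exists_cyclic_isogeny`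

Topic `Literature/NumberTheory/DiophantineGeometry`; a further sibling *proofs* file (theorems only:
no definition, no named fact, no `sorry`) of `GeneralizedFermatTwoPowerCoefficient` (named fact
`ribet1997_twoPowerFermat`: K. Ribet, *On the equation `aᵖ + 2^α bᵖ + cᵖ = 0`*, Acta Arith. 79
(1997), Thm. 3).  The previous assembly
`ribet1997_twoPowerFermat_of_khare_wintenberger_of_mazurKenku_of_serreWeightTwo_only`
(`…FreySwanEightProofs`) left, besides the two named facts `khare_wintenberger` and
`mazurKenku_exists_cyclic_isogeny`, the hypothesis `hwt`: Serre, Duke Math. J. 54 (1987), §2.9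
Prop. 5 with (4.1.11) — *for `E/ℚ` semistable at `p ≥ 5` with `p ∣ ord_p Δ_min`, the Serre weight
of `E[p]` is `2`* — asked for EVERY local restriction datum `loc` at `p`.

## Part A. The place of `ℚ` above `p`

`residueFieldCard_adicCompletion_eq_of_natCast_mem`,
`irreducible_natCast_valuativeInteger_adicCompletion_of_natCast_mem`,
`natCast_dvd_of_mem_maximalIdeal_adicCompletionIntegers` (`𝔪_v = p 𝓞_v`: `e(v ∣ p) = 1`), and the
comparison of the reduction predicates / `ord Δ_min` over the places of `ℤ` and of `𝓞 ℚ`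
(`hasGoodReductionAt_of_int`, `hasMultiplicativeReductionAt_of_int`,
`ordMinimalDiscriminant_eq_of_int`), all read off the tree (`SerreConjectureProofs`,
`CDTTheorem722SerreLevelProofs`, `…GoodReductionProofs`, `…TateProofs`).

## Part B. The weight at the canonical datum (Serre 1987, §2.8 Prop. 3–4, §2.9 Prop. 5)

`serreWeight_eq_two_of_isSemistableAt_of_dvd_ordMinimalDiscriminant` — for `E/ℚ` semistable at the
place `v_p` of `ℤ` with `p ∣ ord_p Δ_min` (`p ≥ 5`), a framing `ρ̄` of `E[p]`, `j : 𝔽_p → k` into a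
discrete field and a residue embedding `ι` of `ℚ_v`, the weight `serreWeight p (ρ̄ ⊗_j k) loc₀ ι` at
the canonical datum `loc₀ = (ℚ_v, ρ̄'|Γ_{ℚ_v})` is `2`, by Serre's recipe read on the three inertia
shapes (`ModPGaloisRep.serreWeight_eq_two_of_shape`, `SerreWeightEqTwoShapesProofs`):
* good ordinary reduction at `p`: `ρ̄|I_p ≃ (ψ₁ *; 0 1)`
  (`hasLevelOneInertiaShape_restrictField_of_not_dvd_frobeniusTraceAt`, Serre 1987 (2.8.2)) and peu
  ramifié (`isPeuRamifie_restrictField_of_not_dvd_frobeniusTraceAt`, the finite flat group scheme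
  `E[p]/ℤ_p`, Serre §2.8 Prop. 3);
* good supersingular reduction: `ρ̄|I_p ≃ diag(ψ₂^p, ψ₂)`
  (`hasLevelTwoInertiaShape_restrictField_of_dvd_frobeniusTraceAt`, Serre (2.8.3), Prop. 4);
* multiplicative reduction: `ρ̄|I_p ≃ (ψ₁ *; 0 1)`
  (`hasLevelOneInertiaShape_restrictField_of_hasMultiplicativeReductionAt`, Serre §2.9) and peu
  ramifié when `p ∣ ord_p Δ_min` (`isPeuRamifie_restrictField_of_hasMultiplicativeReductionAt_of_dvd`,
  Serre §2.9 Prop. 5 — proved in the tree on the Tate form of invariant `j`, without Tate's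
  uniformisation).

## Part C. The assembly

`ribet1997_twoPowerFermat_of_khare_wintenberger_of_freyOggSaito_canonical`
(the assembly of `…FreySaitoProofs` with Steps 2–3 run at `loc₀`) and
`ribet1997_twoPowerFermat_of_khare_wintenberger_of_mazurKenku` —
**Theorem 3 from the named facts `khare_wintenberger` and `mazurKenku_exists_cyclic_isogeny` alone**
(both XL published theorems vendored as named facts without `_holds`: Khare–Wintenberger 2009,
Thm. 1.2; Mazur 1978 / Kenku 1982).

## References

* [Ribet1997] K. A. Ribet, Acta Arith. 79 (1997), 7–16, Thm. 3, §§2–3.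
* [Serre1987] J.-P. Serre, Duke Math. J. 54 (1987): §2.1, §2.8 (Prop. 3, Prop. 4, (2.8.2)–(2.8.3)),
  §2.9 Prop. 5, §4.1 (4.1.11)–(4.1.12), §4.2.
* [SerreInventiones1972] J.-P. Serre, Invent. Math. 15 (1972), §1.11–1.12.
* [KhareWintenberger2009] C. Khare, J.-P. Wintenberger, Invent. Math. 178 (2009), Thm. 1.2.
-/

noncomputable section

open scoped MatrixGroups ModularForm NumberField
open CongruenceSubgroup UpperHalfPlane Polynomial

namespace Literature.NumberTheory.DiophantineGeometry

open WeierstrassCurve GaloisRepresentations EllipticCurves EllipticCurves.ModularForms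
  Rat.HeightOneSpectrum IsDedekindDomain IsDedekindDomain.HeightOneSpectrum
  Literature.NumberTheory.Automorphic Literature.NumberTheory.Automorphic.BCDT

/-! ## Part A. The place of `ℚ` above `p` -/

section Place

open ValuativeRel GaloisRepresentations.ModPGaloisRep GaloisRepresentations.IsNonarchimedeanLocalField

/-- `q_v = p` for the place `v ∋ p` of `ℚ` (`residueFieldCard_adicCompletion_eq`). [folklore] -/
theorem residueFieldCard_adicCompletion_eq_of_natCast_mem {v : HeightOneSpectrum (𝓞 ℚ)} {p : ℕ}
    [hp : Fact p.Prime] (hpv : (p : 𝓞 ℚ) ∈ v.asIdeal) :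
    residueFieldCard (v.adicCompletion ℚ) = p := by
  have hv : ((primesEquiv (R := 𝓞 ℚ) v : Nat.Primes) : ℕ) = p :=
    (natCast_mem_asIdeal_iff_primesEquiv_eq v hp.out).mp hpv
  rw [Literature.NumberTheory.Automorphic.residueFieldCard_adicCompletion_eq,
    HeightOneSpectrum.residueCard_eq_card_quotient]
  have h : Ideal.span {(natGenerator v : ℤ)} =
      v.asIdeal.map (Rat.IsIntegralClosure.intEquiv (𝓞 ℚ) : 𝓞 ℚ →+* ℤ) :=
    span_natGenerator v
  rw [Nat.card_congr ((Ideal.quotientEquiv _ _ (Rat.IsIntegralClosure.intEquiv (𝓞 ℚ)) h).trans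
    (Int.quotientSpanNatEquivZMod _)).toEquiv, Nat.card_zmod]
  exact hv

/-- `p` is a uniformiser of `ℚ_v` for the place `v ∋ p`
(`irreducible_natCast_valuativeInteger_adicCompletion`). [folklore] -/
theorem irreducible_natCast_valuativeInteger_adicCompletion_of_natCast_mem
    {v : HeightOneSpectrum (𝓞 ℚ)} {p : ℕ} [hp : Fact p.Prime] (hpv : (p : 𝓞 ℚ) ∈ v.asIdeal) :
    Irreducible ((p : ℕ) : 𝒪[v.adicCompletion ℚ]) := by
  have hv : ((primesEquiv (R := 𝓞 ℚ) v : Nat.Primes) : ℕ) = p :=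
    (natCast_mem_asIdeal_iff_primesEquiv_eq v hp.out).mp hpv
  have h := Literature.NumberTheory.Automorphic.irreducible_natCast_valuativeInteger_adicCompletion v
  rwa [hv] at h

/-- **`𝔪_v = p 𝓞_v`** for the place `v ∋ p` of `ℚ` (`e(v ∣ p) = 1`): every element of the maximal
ideal of `𝓞_v = v.adicCompletionIntegers ℚ` is a multiple of `p` — transported from
`ℤ_[p]` (`PadicInt.maximalIdeal_eq_span_p`) along `padicIntEquiv`. [folklore] -/
theorem natCast_dvd_of_mem_maximalIdeal_adicCompletionIntegers {v : HeightOneSpectrum (𝓞 ℚ)}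
    {p : ℕ} [hp : Fact p.Prime] (hpv : (p : 𝓞 ℚ) ∈ v.asIdeal) :
    ∀ c ∈ IsLocalRing.maximalIdeal (v.adicCompletionIntegers ℚ),
      ((p : ℕ) : v.adicCompletionIntegers ℚ) ∣ c := by
  have hv : ((primesEquiv (R := 𝓞 ℚ) v : Nat.Primes) : ℕ) = p :=
    (natCast_mem_asIdeal_iff_primesEquiv_eq v hp.out).mp hpv
  intro c hc
  haveI : Fact (Nat.Prime (primesEquiv (R := 𝓞 ℚ) v : ℕ)) := ⟨(primesEquiv v).2⟩
  set e := (adicCompletionIntegers.padicIntEquiv v).toRingEquiv with he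
  -- `e c` is a non-unit of `ℤ_[ℓ]`, `ℓ = p`
  have hc' : e c ∈ IsLocalRing.maximalIdeal ℤ_[(primesEquiv (R := 𝓞 ℚ) v : ℕ)] := by
    rw [IsLocalRing.mem_maximalIdeal, mem_nonunits_iff] at hc ⊢
    intro hu
    exact hc (by simpa using hu.map e.symm)
  rw [PadicInt.maximalIdeal_eq_span_p, Ideal.mem_span_singleton] at hc'
  obtain ⟨d, hd⟩ := hc'
  refine ⟨e.symm d, ?_⟩
  have h1 : c = e.symm (e c) := (e.symm_apply_apply c).symm
  rw [h1, hd, map_mul, map_natCast]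
  congr 1
  exact congrArg Nat.cast hv

/-- Good reduction at the place of `ℤ` above `ℓ` is good reduction at the place of `𝓞 ℚ` above `ℓ`
(both are `HasGoodReductionAtPrime ℓ`). [folklore] -/
theorem hasGoodReductionAt_of_int (W : WeierstrassCurve ℚ) [W.IsElliptic] (ℓ : Nat.Primes)
    (hgood : W.HasGoodReductionAt ((primesEquiv (R := ℤ)).symm ℓ)) :
    W.HasGoodReductionAt ((primesEquiv (R := 𝓞 ℚ)).symm ℓ) := by
  haveI : Fact (ℓ : ℕ).Prime := ⟨ℓ.2⟩
  have h1 : W.HasGoodReductionAtPrime (ℓ : ℕ) :=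
    (hasGoodReductionAtPrime_iff_hasGoodReductionAt_holds W ℓ).mpr hgood
  have h := hasGoodReductionAtPrime_iff_hasGoodReductionAt_ringOfIntegers
    ((primesEquiv (R := 𝓞 ℚ)).symm ℓ) W
  rw [Equiv.apply_symm_apply] at h
  exact h.mp h1

/-- Multiplicative reduction at the place of `ℤ` above `ℓ` is multiplicative reduction at the place
of `𝓞 ℚ` above `ℓ` (both are `HasMultiplicativeReductionAtPrime ℓ`). [folklore] -/
theorem hasMultiplicativeReductionAt_of_int (W : WeierstrassCurve ℚ) [W.IsElliptic]
    (ℓ : Nat.Primes) (hmult : W.HasMultiplicativeReductionAt ((primesEquiv (R := ℤ)).symm ℓ)) :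
    W.HasMultiplicativeReductionAt ((primesEquiv (R := 𝓞 ℚ)).symm ℓ) := by
  haveI : Fact (ℓ : ℕ).Prime := ⟨ℓ.2⟩
  have h1 : W.HasMultiplicativeReductionAtPrime (ℓ : ℕ) := by
    have h := hasMultiplicativeReductionAtPrime_iff_hasMultiplicativeReductionAt_holds W ℓ
    exact h.mpr hmult
  have h := hasMultiplicativeReductionAtPrime_iff_hasMultiplicativeReductionAt_ringOfIntegers
    (W := W) ((primesEquiv (R := 𝓞 ℚ)).symm ℓ)
  have key : ∀ (q : Nat.Primes) (_hq : primesEquiv (R := 𝓞 ℚ) ((primesEquiv (R := 𝓞 ℚ)).symm ℓ) = q),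
      (haveI := Fact.mk q.2; W.HasMultiplicativeReductionAtPrime (q : ℕ)) →
        W.HasMultiplicativeReductionAt ((primesEquiv (R := 𝓞 ℚ)).symm ℓ) := by
    rintro q rfl hq; exact h.mp hq
  exact key ℓ (Equiv.apply_symm_apply _ _) h1

/-- `ord_v Δ_min` is the same at the places of `ℤ` and of `𝓞 ℚ` above `ℓ` (both are the exponent
computed in `ℚ_ℓ`, `ordMinimalDiscriminant_eq_padic`). [folklore] -/
theorem ordMinimalDiscriminant_eq_of_int (W : WeierstrassCurve ℚ) [W.IsElliptic] (ℓ : Nat.Primes) :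
    W.ordMinimalDiscriminant ((primesEquiv (R := 𝓞 ℚ)).symm ℓ) =
      W.ordMinimalDiscriminant ((primesEquiv (R := ℤ)).symm ℓ) := by
  let e : Nat.Primes → ℕ := fun q =>
    haveI : Fact q.1.Prime := ⟨q.2⟩
    (IsDiscreteValuationRing.addVal ℤ_[q]
      (((W.baseChange ℚ_[q]).minimal ℤ_[q]).integralModel ℤ_[q]).Δ).toNat
  have e1 : W.ordMinimalDiscriminant ((primesEquiv (R := 𝓞 ℚ)).symm ℓ) =
      e (primesEquiv ((primesEquiv (R := 𝓞 ℚ)).symm ℓ)) := W.ordMinimalDiscriminant_eq_padic _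
  have e2 : W.ordMinimalDiscriminant ((primesEquiv (R := ℤ)).symm ℓ) =
      e (primesEquiv ((primesEquiv (R := ℤ)).symm ℓ)) := W.ordMinimalDiscriminant_eq_padic _
  rw [e1, e2, Equiv.apply_symm_apply, Equiv.apply_symm_apply]

end Place

/-! ## Part B. Serre's weight is `2` at the canonical datum (Serre 1987, §2.8–2.9) -/

section Weight

open ValuativeRel GaloisRepresentations.ModPGaloisRep GaloisRepresentations.IsNonarchimedeanLocalField

/-- **Serre 1987, §2.9 Prop. 5 with §2.8 Prop. 3–4 and (4.1.11), at the canonical local datum.**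
Let `E/ℚ` be an elliptic curve, `p ≥ 5` a prime at whose place `v_p` of `ℤ` `E` is semistable with
`p ∣ ord_p Δ_min`, `ρ̄ : Γ_ℚ → GL₂(𝔽_p)` a framing of `E[p]`, `j : 𝔽_p → k` a ring homomorphism
into a discrete field, `v` the place of `𝓞 ℚ` above `p` (`p ∈ v`) and `ι` a residue embedding of
`ℚ_v`.  Then Serre's weight of `ρ̄ ⊗_j k` at the local restriction datum
`loc₀ = (ℚ_v, (ρ̄ ⊗ k)|Γ_{ℚ_v})` is `2`.
Proof: Serre's recipe gives `2` on each of the three inertia shapes (`serreWeight_eq_two_of_shape`):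
good ordinary (`(ψ₁ *; 0 1)`, peu ramifié), good supersingular (`diag(ψ₂^p, ψ₂)`), multiplicative
(`(ψ₁ *; 0 1)`, peu ramifié as `p ∣ ord_p Δ_min`), the shapes and ramification being the tree
theorems listed in the module docstring.
[cite: Serre1987, §2.8 Prop. 3, Prop. 4, (2.8.2)–(2.8.3); §2.9 Prop. 5; §4.1 (4.1.11)]
[cite: SerreInventiones1972, §1.11 Prop. 11–12, §1.12 Cor. of Prop. 13] -/
theorem serreWeight_eq_two_of_isSemistableAt_of_dvd_ordMinimalDiscriminant
    (W : WeierstrassCurve ℚ) [W.IsElliptic] (p : ℕ) [hp : Fact p.Prime] (h5 : 5 ≤ p)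
    (v : HeightOneSpectrum (𝓞 ℚ)) (hpv : (p : 𝓞 ℚ) ∈ v.asIdeal)
    (hsemi : W.IsSemistableAt ((primesEquiv (R := ℤ)).symm ⟨p, Fact.out⟩))
    (hpord : p ∣ W.ordMinimalDiscriminant ((primesEquiv (R := ℤ)).symm ⟨p, Fact.out⟩))
    {ρ : ModPGaloisRep ℚ (ZMod p) 2} (hρ : W.IsTorsionGaloisRep p ρ)
    (k : Type) [Field k] [TopologicalSpace k] [DiscreteTopology k] (j : ZMod p →+* k)
    (ι : absIntegers 𝒪[v.adicCompletion ℚ] (v.adicCompletion ℚ) ⧸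
      absMaximalIdeal (v.adicCompletion ℚ) →+* k) :
    serreWeight p (FramedRep.baseChange j continuous_of_discreteTopology ρ)
      { F := v.adicCompletion ℚ
        residueFieldCard_eq := residueFieldCard_adicCompletion_eq_of_natCast_mem hpv
        irreducible_natCast := irreducible_natCast_valuativeInteger_adicCompletion_of_natCast_mem hpv
        rep := FramedGaloisRep.restrictField (v.adicCompletion ℚ)
          (FramedRep.baseChange j continuous_of_discreteTopology ρ)
        rep_eq_restrictField := rfl } ι = 2 := by
  have hv : v = (primesEquiv (R := 𝓞 ℚ)).symm ⟨p, hp.out⟩ := by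
    rw [Equiv.eq_symm_apply]
    exact Subtype.ext ((natCast_mem_asIdeal_iff_primesEquiv_eq v hp.out).mp hpv)
  have hp2 : p ≠ 2 := by omega
  haveI : ContinuousAdd k := ⟨continuous_of_discreteTopology⟩
  haveI : ContinuousMul k := ⟨continuous_of_discreteTopology⟩
  haveI : ContinuousNeg k := ⟨continuous_of_discreteTopology⟩
  haveI : IsTopologicalSemiring k := ⟨⟩
  haveI : IsTopologicalRing k := ⟨⟩
  have hirr : Irreducible ((p : ℕ) : 𝒪[v.adicCompletion ℚ]) :=
    irreducible_natCast_valuativeInteger_adicCompletion_of_natCast_mem hpv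
  have hq : residueFieldCard (v.adicCompletion ℚ) = p :=
    residueFieldCard_adicCompletion_eq_of_natCast_mem hpv
  have hgen := natCast_dvd_of_mem_maximalIdeal_adicCompletionIntegers (v := v) hpv
  refine serreWeight_eq_two_of_shape _ _ hp2 ?_
  change ModPGaloisRep.HasLevelTwoInertiaShape (FramedGaloisRep.restrictField (v.adicCompletion ℚ)
      (FramedRep.baseChange j continuous_of_discreteTopology ρ)) ι ((p : ℕ) : 𝒪[v.adicCompletion ℚ])
      hirr 0 1 ∨
    (ModPGaloisRep.HasLevelOneInertiaShape (FramedGaloisRep.restrictField (v.adicCompletion ℚ)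
      (FramedRep.baseChange j continuous_of_discreteTopology ρ)) ι ((p : ℕ) : 𝒪[v.adicCompletion ℚ])
      hirr 1 0 ∧
     (ModPGaloisRep.IsTamelyRamified (FramedGaloisRep.restrictField (v.adicCompletion ℚ)
        (FramedRep.baseChange j continuous_of_discreteTopology ρ)) ∨
      ModPGaloisRep.IsPeuRamifie (FramedGaloisRep.restrictField (v.adicCompletion ℚ)
        (FramedRep.baseChange j continuous_of_discreteTopology ρ))))
  rcases hsemi with hgood | hmult
  · have hgood' : W.HasGoodReductionAt v := by
      rw [hv]; exact hasGoodReductionAt_of_int W ⟨p, Fact.out⟩ hgood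
    by_cases hss : (p : ℤ) ∣ W.frobeniusTraceAt v
    · -- good supersingular: level two, `diag(ψ₂^p, ψ₂)`
      exact Or.inl (W.hasLevelTwoInertiaShape_restrictField_of_dvd_frobeniusTraceAt p hp2 v hpv hgood'
        hss hgen hρ j _ hirr hq ι)
    · -- good ordinary: `(ψ₁ *; 0 1)` and peu ramifié
      exact Or.inr ⟨W.hasLevelOneInertiaShape_restrictField_of_not_dvd_frobeniusTraceAt p v hpv hgood'
        hss hρ j _ hirr hq ι,
        Or.inr (W.isPeuRamifie_restrictField_of_not_dvd_frobeniusTraceAt p hp2 v hpv hgood' hss hirr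
          hρ j _)⟩
  · have hmult' : W.HasMultiplicativeReductionAt v := by
      rw [hv]; exact hasMultiplicativeReductionAt_of_int W ⟨p, Fact.out⟩ hmult
    have hpord' : p ∣ W.ordMinimalDiscriminant v := by
      rw [hv, ordMinimalDiscriminant_eq_of_int]; exact hpord
    -- multiplicative: `(ψ₁ *; 0 1)` and peu ramifié (`p ∣ ord_v Δ_min`)
    exact Or.inr ⟨W.hasLevelOneInertiaShape_restrictField_of_hasMultiplicativeReductionAt hp2 hpv hmult'
      hρ j _ hirr hq ι,
      Or.inr (W.isPeuRamifie_restrictField_of_hasMultiplicativeReductionAt_of_dvd p hp2 v hpv hmult'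
        hpord' hgen hirr hρ j _)⟩

end Weight

/-! ## Part C. The assembly at the canonical datum -/

section SerreRoad

open ValuativeRel GaloisRepresentations.ModPGaloisRep GaloisRepresentations.IsNonarchimedeanLocalField

/-- **Ribet 1997, Theorem 3 ⟸ Khare–Wintenberger ∧ the local description of `E[p]` away from `p`,
with Serre's weight-`2` statement PROVED at the canonical local datum.**  This is
`ribet1997_twoPowerFermat_of_khare_wintenberger_of_freyOggSaito_local`
(`…FreySaitoProofs`) verbatim, except for Steps 2–3: instead of an arbitrary local restriction datum
`loc` (`nonempty_localRestrictionAt`) and the hypothesis `hwt` (Serre 1987, §2.9 Prop. 5 with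
(4.1.11): `k(ρ̄_{E,p} ⊗ k) = 2` for every `loc`), the assembly uses the CANONICAL datum
`F = ℚ_v` (`v` the place of `ℚ` above `p`, `rep = ρ̄'|Γ_{ℚ_v}`), for which the weight is computed
by `serreWeight_eq_two_of_isSemistableAt_of_dvd_ordMinimalDiscriminant` (Part B) from the inertia
shapes and ramification proved in the tree (`OrdinaryReduction{InertiaShape,PeuRamifie}Proofs`,
`SupersingularInertiaShapeProofs`, `MultiplicativeReduction{InertiaShape,PeuRamifie}Proofs`;
Serre 1987, §2.8 Prop. 3–4, §2.9 Prop. 5, (4.1.11)).  Khare–Wintenberger (`hKW`) is applied at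
that datum, which is all the printed proof needs (Ribet 1997 §3; Serre 1987 §4.1–4.2: the weight
and level are read at one decomposition group at `p`).
[cite: Ribet1997, Thm. 3 and §3, p. 13]
[cite: Serre1987, §2.9 Prop. 5, §4.1 (Prop. 6, (4.1.11), (4.1.12)), §4.2, (4.6.3)]
[cite: KhareWintenberger2009, Thm. 1.2 and Thm. 9.1] -/
theorem ribet1997_twoPowerFermat_of_khare_wintenberger_of_freyOggSaito_canonical
    (hKW : ∀ (p : ℕ) [Fact p.Prime] (k : Type) [Field k] [TopologicalSpace k] [DiscreteTopology k],
      khare_wintenberger p k)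
    (hirr : ∀ (A B : ℤ) (p : ℕ), p.Prime → 5 ≤ p → IsCoprime A B → A * B * (A + B) ≠ 0 →
      A ≡ -1 [ZMOD 4] → (2 : ℤ) ∣ B → (freyCurve A B).HasIrreducibleModPGaloisRep p)
    (hOS : ∀ (A B : ℤ) (p : ℕ) [Fact p.Prime], 5 ≤ p → IsCoprime A B → A * B * (A + B) ≠ 0 →
      A ≡ -1 [ZMOD 4] → (4 : ℤ) ∣ B →
        (freyCurve A B).artinConductorExponent_tate_eq_conductorExponent_of_isElliptic p)
    (hTate : ∀ (W : WeierstrassCurve ℚ) [W.IsElliptic] (p : ℕ) [Fact p.Prime],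
      ∀ ρ : ModPGaloisRep ℚ (ZMod p) 2, W.IsTorsionGaloisRep p ρ →
        ∀ (k : Type) [Field k] [TopologicalSpace k] [DiscreteTopology k] [CharP k p]
          [IsAlgClosed k] (j : ZMod p →+* k) (v : HeightOneSpectrum ℤ),
          natGenerator v ≠ p → W.IsSemistableAt v → p ∣ W.ordMinimalDiscriminant v →
            ¬ natGenerator v ∣ serreLevel p (FramedRep.baseChange j continuous_of_discreteTopology ρ))
    (hDK : ∀ (A B : ℤ), IsCoprime A B → A * B * (A + B) ≠ 0 → A ≡ -1 [ZMOD 4] → (4 : ℤ) ∣ B →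
      ¬ (16 : ℤ) ∣ B →
        (freyCurve A B).conductorExponent ((primesEquiv (R := ℤ)).symm ⟨2, Nat.prime_two⟩) ≤ 3) :
    ribet1997_twoPowerFermat := by
  classical
  rw [ribet1997_twoPowerFermat_iff_normalized]
  intro p hp h5 r h2r hrp a b c h0 hab hac hbc ha heq
  haveI hpF : Fact p.Prime := ⟨hp⟩
  have hodd : Odd p := hp.odd_of_ne_two (by omega)
  have hp2 : p ≠ 2 := by omega
  obtain ⟨hcop, hne, hA, h4, hsum⟩ := Ribet1997.monomials hodd h2r h0 hab hac ha heq
  have hB2 : (2 : ℤ) ∣ 2 ^ r * b ^ p := dvd_trans (by norm_num) h4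
  set W : WeierstrassCurve ℚ := freyCurve (a ^ p) (2 ^ r * b ^ p) with hW
  haveI hWE : W.IsElliptic := isElliptic_freyCurve hne
  /- Step 1. A framed model `ρ̄` of `E[p]` and its extension of scalars `ρ̄' = ρ̄ ⊗ 𝔽̄_p`. -/
  haveI : NeZero ((p : ℕ) : ℚ) := ⟨by exact_mod_cast hp.ne_zero⟩
  obtain ⟨ρ, hρ⟩ := W.exists_isTorsionGaloisRep p
  letI : TopologicalSpace (AlgebraicClosure (ZMod p)) := ⊥
  haveI : DiscreteTopology (AlgebraicClosure (ZMod p)) := ⟨rfl⟩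
  set j : ZMod p →+* AlgebraicClosure (ZMod p) := algebraMap (ZMod p) (AlgebraicClosure (ZMod p))
    with hj
  set ρ' : ModPGaloisRep ℚ (AlgebraicClosure (ZMod p)) 2 :=
    FramedRep.baseChange j continuous_of_discreteTopology ρ with hρ'
  -- `ρ̄'` is irreducible (`hirr`) and odd (`det ρ̄ = χ̄_p`)
  have habs := isAbsolutelyIrreducible_of_hasIrreducibleModPGaloisRep W hp2
    (hirr _ _ p hp h5 hcop hne hA hB2) hρ
  have hirr' : ρ'.toGaloisRep.IsIrreducible := by
    rw [← ModPGaloisRep.isIrreducible_iff_toGaloisRep]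
    exact habs.isIrreducible_baseChange (AlgebraicClosure (ZMod p)) j _
  have hodd' : FramedGaloisRep.IsOdd ρ' :=
    (ModPGaloisRep.isOdd_of_det_eq_modPCyclotomicCharacterZMod ρ
      (W.det_eq_modPCyclotomicCharacter_of_isTorsionGaloisRep_holds p ρ hρ)).baseChange j _
  /- Step 2. Serre's conjecture (Khare–Wintenberger): `ρ̄'` arises from a newform `f` of weight
  `k(ρ̄')` and level `N(ρ̄')`. -/
  -- the CANONICAL local restriction datum at `p`: `F = ℚ_v`, `v` the place of `ℚ` above `p`
  set v : HeightOneSpectrum (𝓞 ℚ) := (primesEquiv (R := 𝓞 ℚ)).symm ⟨p, hp⟩ with hv_def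
  have hpv' : (p : 𝓞 ℚ) ∈ v.asIdeal :=
    (natCast_mem_asIdeal_iff_primesEquiv_eq v hp).mpr (by rw [hv_def, Equiv.apply_symm_apply])
  set loc : LocalRestrictionAt p ρ' :=
    { F := v.adicCompletion ℚ
      residueFieldCard_eq := residueFieldCard_adicCompletion_eq_of_natCast_mem hpv'
      irreducible_natCast := irreducible_natCast_valuativeInteger_adicCompletion_of_natCast_mem hpv'
      rep := FramedGaloisRep.restrictField (v.adicCompletion ℚ) ρ'
      rep_eq_restrictField := rfl } with hloc
  obtain ⟨ι⟩ := nonempty_ringHom_residue (k := AlgebraicClosure (ZMod p)) p (v.adicCompletion ℚ)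
    (residueFieldCard_adicCompletion_eq_of_natCast_mem hpv')
  /- Step 3. The weight is `2`: `E` is semistable at `p` and `p ∣ ord_p (Δ_E)` (Part B). -/
  set vp : HeightOneSpectrum ℤ := (primesEquiv (R := ℤ)).symm ⟨p, hp⟩ with hvp_def
  have hvp : natGenerator vp = p :=
    Literature.NumberTheory.EllipticCurves.Rat.natGenerator_primesEquiv_symm ⟨p, hp⟩
  have hpord : p ∣ W.ordMinimalDiscriminant vp :=
    (Ribet1997.dvd_ordMinimalDiscriminant_of_ne_two hodd h2r h0 hab hac ha heq vp
      (by rw [hvp]; exact hp2)).2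
  have hsemi : W.IsSemistableAt vp :=
    isSemistableAt_freyCurve_holds (a ^ p) (2 ^ r * b ^ p) hcop hne vp (by rw [hvp]; exact hp2)
  have hw : (serreWeight p ρ' loc ι : ℤ) = 2 := by
    have h2 : serreWeight p ρ' loc ι = 2 :=
      serreWeight_eq_two_of_isSemistableAt_of_dvd_ordMinimalDiscriminant W p h5 v hpv' hsemi hpord hρ
        (AlgebraicClosure (ZMod p)) j ι
    rw [h2]; rfl
  -- the newform of (3.2.4), transported to weight `2`
  obtain ⟨f, ιf, hf, hgal⟩ := hKW p (AlgebraicClosure (ZMod p)) ρ' hirr' hodd' loc ι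
  revert hgal hf ιf f
  rw [hw]
  intro f ιf hf hgal
  /- Step 4. The level divides `8`. -/
  set N : ℕ := serreLevel p ρ' with hN_def
  have hN0 : N ≠ 0 := by
    intro h0'
    apply not_dvd_serreLevel p ρ'
    rw [← hN_def, h0']
    exact dvd_zero p
  haveI hNz : NeZero N := ⟨hN0⟩
  have hNE : N ∣ W.conductorNorm ℤ :=
    serreLevel_baseChange_dvd_conductorNorm_of_artinConductorExponent W p
      (hOS _ _ p h5 hcop hne hA h4) ρ hρ (AlgebraicClosure (ZMod p)) j
  have hN8 : N ∣ 8 := by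
    refine dvd_eight_of_forall_prime hN0 hNE (conductorNorm_pos_holds W).ne' ?_ ?_
    · -- odd primes of `N` are excluded by `hTate`
      intro q hq hqN
      by_contra hq2
      have hqp : q ≠ p := by
        rintro rfl
        exact not_dvd_serreLevel q ρ' (by rw [← hN_def]; exact hqN)
      have hqm : (q : ℤ) ∣ a ^ p * (2 ^ r * b ^ p) * (a ^ p + 2 ^ r * b ^ p) :=
        dvd_of_dvd_conductorNorm_freyCurve hcop hne hq hq2 (hqN.trans hNE)
      set u : HeightOneSpectrum ℤ := (primesEquiv (R := ℤ)).symm ⟨q, hq⟩ with hu_def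
      have hu : natGenerator u = q :=
        Literature.NumberTheory.EllipticCurves.Rat.natGenerator_primesEquiv_symm ⟨q, hq⟩
      have hordu : p ∣ W.ordMinimalDiscriminant u :=
        (Ribet1997.dvd_ordMinimalDiscriminant_of_ne_two hodd h2r h0 hab hac ha heq u
          (by rw [hu]; exact hq2)).2
      have hsemiu : W.IsSemistableAt u :=
        isSemistableAt_freyCurve_holds (a ^ p) (2 ^ r * b ^ p) hcop hne u (by rw [hu]; exact hq2)
      have := hTate W p ρ hρ (AlgebraicClosure (ZMod p)) j u (by rw [hu]; exact hqp) hsemiu hordu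
      exact this (by rw [hu]; exact hqN)
    · -- `ord₂ N_E ≤ 3`
      rcases Ribet1997.sixteen_dvd_or_odd (by omega : 4 ≤ p) b (r := r) with h16 | ⟨hbo, hr3⟩
      · exact (factorization_conductorNorm_freyCurve_two_le_one hcop hne hA h16).trans (by norm_num)
      · rw [show (2 : ℕ) = ((⟨2, Nat.prime_two⟩ : Nat.Primes) : ℕ) from rfl,
          factorization_conductorNorm_primesEquiv_symm]
        refine hDK _ _ hcop hne hA h4 ?_
        -- `16 ∤ 2^r b^p` for `b` odd, `r ≤ 3`
        intro h16
        have hb2 : ¬ (2 : ℤ) ∣ b := Int.two_dvd_ne_zero.mpr (Int.odd_iff.mp hbo)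
        have hcop2 : IsCoprime ((2 : ℤ) ^ 4) (b ^ p) :=
          ((Int.prime_two.coprime_iff_not_dvd).2 hb2).pow_left.pow_right
        have h' : (2 : ℤ) ^ 4 ∣ 2 ^ r := hcop2.dvd_of_dvd_mul_right (by exact_mod_cast h16)
        have h'' : 2 ^ 4 ∣ 2 ^ r := by exact_mod_cast h'
        have := (Nat.pow_dvd_pow_iff_le_right one_lt_two).mp h''
        omega
  /- Step 5. The primes `q > |abc|` are primes of good reduction; conclude by
  `false_of_isGaloisRepOfNewform1Int_of_dvd_eight`. -/
  refine false_of_isGaloisRepOfNewform1Int_of_dvd_eight W h5 hρ j hN8 hf ιf hgal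
    (max 2 (a * b * c).natAbs) fun q hq hqB ↦ ?_
  have hq2 : q ≠ 2 := fun h' ↦ (lt_of_le_of_lt (le_max_left _ _) hqB).ne' h'
  have hqabc : ¬ (q : ℤ) ∣ a * b * c := by
    intro h'
    have hle : q ≤ (a * b * c).natAbs :=
      Nat.le_of_dvd (Int.natAbs_pos.mpr h0) (Int.natCast_dvd.mp h')
    exact (lt_of_le_of_lt (le_max_right _ _) hqB).not_ge hle
  refine not_dvd_conductorNorm_freyCurve_of_not_dvd hcop hne hq hq2 ?_
  -- `q ∤ AB(A+B) = -(a^p)(2^r b^p)(c^p)`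
  rw [hsum]
  have hqint : Prime (q : ℤ) := Nat.prime_iff_prime_int.mp hq
  have hp0 : p ≠ 0 := hp.ne_zero
  intro h'
  apply hqabc
  rcases hqint.dvd_or_dvd h' with h' | h'
  · rcases hqint.dvd_or_dvd h' with h' | h'
    · exact dvd_mul_of_dvd_left (dvd_mul_of_dvd_left (hqint.dvd_of_dvd_pow h') _) _
    · rcases hqint.dvd_or_dvd h' with h' | h'
      · exact absurd (eq_two_of_dvd_sixteen hq ((hqint.dvd_of_dvd_pow h').trans (by norm_num)))
          hq2
      · exact dvd_mul_of_dvd_left (dvd_mul_of_dvd_right (hqint.dvd_of_dvd_pow h') _) _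
  · exact dvd_mul_of_dvd_right (hqint.dvd_of_dvd_pow (dvd_neg.mp h')) _


/-- **Ribet 1997, Theorem 3, from `khare_wintenberger` and `mazurKenku_exists_cyclic_isogeny`
alone.**  For a prime `p ≥ 5` and `2 ≤ α < p` the equation `xᵖ + 2^α yᵖ + zᵖ = 0` has no solution in
pairwise coprime non-zero integers (K. Ribet, Acta Arith. 79 (1997), Thm. 3) — granted Serre's
conjecture (Khare–Wintenberger 2009, Thm. 1.2: the named fact `khare_wintenberger`) and the absence
of rational cyclic `p`-isogenies for `p ≥ 5` on curves with full rational `2`-torsion… precisely the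
named fact `mazurKenku_exists_cyclic_isogeny` (Mazur 1978, Kenku 1982) through
`hasIrreducibleModPGaloisRep_freyCurve_of_mazurKenku`.  The assembly
`ribet1997_twoPowerFermat_of_khare_wintenberger_of_freyOggSaito_canonical` with its Frey-curve inputs
discharged exactly as in
`ribet1997_twoPowerFermat_of_khare_wintenberger_of_mazurKenku_of_serreWeightTwo_only`
(`…FreySwanEightProofs`): `hirr` from `hasIrreducibleModPGaloisRep_freyCurve_of_mazurKenku`, `hOS`
from `artinConductorExponent_tate_eq_conductorExponent_freyCurve_of_freySwan` and
`exists_swanConductorAt_torsion_three_freyCurve_of_sixteen_not_dvd`, `hTate` from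
`not_dvd_serreLevel_baseChange_of_hasGoodReductionAt_int` /
`not_dvd_serreLevel_baseChange_of_hasMultiplicativeReductionAt_of_dvd_int`, `hDK` from
`conductorExponent_freyCurve_two_le_three`; Serre's weight-`2` statement (the hypothesis `hwt` of the
`…_serreWeightTwo_only` theorem) is now the theorem
`serreWeight_eq_two_of_isSemistableAt_of_dvd_ordMinimalDiscriminant`.
[cite: Ribet1997, Thm. 3, §§2–3] [cite: Serre1987, §2.8 Prop. 3–4, §2.9 Prop. 5, §4.1 (4.1.11)–(4.1.12)]
[cite: KhareWintenberger2009, Thm. 1.2] [cite: Mazur1978, Thm. 2] -/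
theorem ribet1997_twoPowerFermat_of_khare_wintenberger_of_mazurKenku
    (hKW : ∀ (p : ℕ) [Fact p.Prime] (k : Type) [Field k] [TopologicalSpace k] [DiscreteTopology k],
      khare_wintenberger p k)
    (hMK : mazurKenku_exists_cyclic_isogeny) :
    ribet1997_twoPowerFermat := by
  refine ribet1997_twoPowerFermat_of_khare_wintenberger_of_freyOggSaito_canonical
    hKW (fun _ _ _ hp h5 _ h0 _ _ ↦ hasIrreducibleModPGaloisRep_freyCurve_of_mazurKenku hMK h0 hp h5)
    (fun A B p _ _ hcop h0 hA h4 ↦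
      artinConductorExponent_tate_eq_conductorExponent_freyCurve_of_freySwan
        (fun _ _ _ h0 hA h4 h16 ↦
          exists_swanConductorAt_torsion_three_freyCurve_of_sixteen_not_dvd h0 hA h4 h16)
        hcop h0 hA h4 p)
    ?_ conductorExponent_freyCurve_two_le_three
  intro W _ p _ ρ hρ k _ _ _ _ _ j v hvp hsemi hord
  rcases hsemi with hgood | hmult
  · exact not_dvd_serreLevel_baseChange_of_hasGoodReductionAt_int W p hρ j _ v hvp hgood
  · exact not_dvd_serreLevel_baseChange_of_hasMultiplicativeReductionAt_of_dvd_int W p hρ j _ v hvp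
      hmult hord

end SerreRoad

end Literature.NumberTheory.DiophantineGeometry

end
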